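import Summits.Ventures.CertifiedManyBodySolver.Observables.StiffnessTLOddMomentOrbitRowTT
import HarnessLib

/-!
# Ventures/CertifiedManyBodySolver — Observables: the `λ = 0` (pure f-sum) case of the `t–t'` odd-moment
# stiffness row = the KINETIC stiffness edge at any `t'` (e.g. the A0 anchor `t' = −1/4`)

HONEST FRAMING: one-sided certified stiffness CEILING (f-sum / kinetic class); not informative vs print; not a
superconductivity verdict. Cell hubbard-obs (D-0042), seat p2 (stiffness) g5. Zero compute, no definition, no `sorry`.

The `t–t'` window observable of the odd-moment row is `X_λ = ½k₀^{tt'} + λ d₁ − (λ²/2) m₃'` (`oddMomentObsTT t' U λ`,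
p411872). At `λ = 0` it is literally one half of the `x₁`-advancing kinetic bond observable
`k₀^{tt'} = Σ_σ (c†_{e₁σ}c_{0σ} + h.c.) + t'·Σ_{s}Σ_σ (c†_{j_sσ}c_{0σ} + h.c.)` (`kinBondObsTT t'`, `j₀ = (1,1)`, `j₁ = (1,−1)`)
embedded in `𝔄_{[-7,7]²}`:
* `oddMomentObsTT_lam_zero` — `X₀ = ½ • Γ(incl) k₀^{tt'}`;
* `re_expect_oddMomentObsTT_lam_zero` — `Re ω(X₀) = ½ Re ω(k₀^{tt'})` for every infinite-volume state `ω`;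
so a certified orbit LOWER row on `−X₀ = −oddMomentObsTT t' U 0` (the node shape of the cell's A0 `kinx` edge: objective
`−O_kinx`, `O_kinx = Σ_{r∈S(1,0)} hop_r/8 + t'·Σ_{r∈S(1,1)} hop_r/4`, whose value on every `D₄`-averaged translation-invariant
state is `½ȳ_NN + t'ȳ_NNN = D₄-mean of Re ω(½k₀^{tt'})`) feeds `m3_tpm1o4_fluxStiffness_le_of_oddMoment_orbitLowerRow_neg`
(p411872) with `λ := 0`: `ρ_s(8, 7/8, −1/4) ≤ −r` — the f-sum ceiling at `t' ≠ 0`, where the diagonal bonds enter `k₀` with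
weight `t'` (they advance in `x₁`), which is why no zero-compute twin of the `t' = 0` chord row existed (TARGET.md §2 R-0z′).
* `m3_tpm1o4_fluxStiffness_le_of_kinTT_orbitLowerRow_neg` — the A0 reading spelled with `λ = 0` substituted.
Kinematic comparator (one-body half-bathtub `¼|e₀^{U=0}_{tt'}(n)|`): 0.4019425 at `(7/8, 0)`, 0.3947759 at `(7/8, −1/4)` [float].

References: [ScalapinoWhiteZhang1993] §II; [HazraVermaRanderia2019] eq. (4).
-/

noncomputable section

namespace Summit.Ventures.CertifiedManyBodySolver.Observables

open Matrix Finset Filter Topology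
open Literature.MathematicalPhysics.QuantumLattice
open Literature.MathematicalPhysics.QuantumLattice.ThermodynamicLimit
open Literature.MathematicalPhysics.QuantumFieldTheory
open Literature.Probability.LatticeModels
open scoped ComplexOrder ComplexConjugate Topology

/-- At `λ = 0` the odd-moment window observable is half the embedded `x₁`-kinetic bond observable:
`oddMomentObsTT t' U 0 = ½ • Γ(incl) k₀^{tt'}`. [cite: HazraVermaRanderia2019, eq. (4)] -/
theorem oddMomentObsTT_lam_zero (tp U : ℝ) :
    oddMomentObsTT tp U 0 =
      ((1 / 2 : ℝ) : ℂ) • fermionEmbed (PolySite.incl (box_subset_box (by norm_num))) (kinBondObsTT tp) := by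
  unfold oddMomentObsTT
  simp

/-- `Re ω(X₀) = ½ Re ω(k₀^{tt'})` for every infinite-volume fermion state. [cite: HazraVermaRanderia2019, eq. (4)] -/
theorem re_expect_oddMomentObsTT_lam_zero (tp U : ℝ) (ω : InfVolFermionState 2) :
    (ω.expect (box 2 7) (oddMomentObsTT tp U 0)).re = (1 / 2) * (ω.expect (box 2 1) (kinBondObsTT tp)).re := by
  rw [oddMomentObsTT_lam_zero, map_smul, ω.compatible, smul_eq_mul, Complex.re_ofReal_mul]

/-- **A0 kinetic (f-sum) stiffness reading at `t' = −1/4`.** If `M3CorrOrbitLowerRow (−1/4) u r S (box 2 7) (−oddMomentObsTT (−1/4) 8 0)`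
holds (`S` nonempty; i.e. a certified `D₄`-orbit LOWER row `r` on minus one half of the `x₁`-kinetic bond observable of the
`t–t'` model) and the energy cap `e₀(8, 7/8, −1/4) ≤ u` is certified (node #445 type), then every uniform flux stiffness
`ρ_s` (scale `θ₀ > 0`, all even `L ≥ L₀`) of the zero-flux `(N_L, 0)` sectors of `hubbardTorusTT' L 1 (−1/4) 8` at density `7/8`
satisfies `ρ_s ≤ −r`. (= p411872's consumer at `λ := 0`.) HONEST: kinetic-class ceiling; not informative vs print.
[cite: ScalapinoWhiteZhang1993, §II] -/
theorem m3_tpm1o4_fluxStiffness_le_of_kinTT_orbitLowerRow_neg {u r : ℚ}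
    (S : Finset (DihedralGroup 4)) (hS : S.Nonempty)
    (hrow : M3CorrOrbitLowerRow (-1 / 4) u r S (box 2 7) (-oddMomentObsTT (-1 / 4) 8 0))
    (hu : energyDensityTT' 1 (-1 / 4) 8 (7 / 8) ≤ ((u : ℚ) : ℝ)) :
    ∀ (ρs θ₀ : ℝ), 0 < θ₀ → ∀ L₀ : ℕ,
      (∀ (L : ℕ) [NeZero L], L₀ ≤ L → Even L →
        ∀ θ : ℝ, |θ| ≤ θ₀ →
          ρs * θ ^ 2 ≤ fluxEnergyTT' L (-1 / 4) 8 (1 / 8) θ - fluxEnergyTT' L (-1 / 4) 8 (1 / 8) 0) →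
      ρs ≤ -((r : ℚ) : ℝ) :=
  m3_tpm1o4_fluxStiffness_le_of_oddMoment_orbitLowerRow_neg 0 S hS hrow hu

end Summit.Ventures.CertifiedManyBodySolver.Observables

end
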